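import Literature.AlgebraicGeometry.Frobenioids.Thm49FunctorialPullbacks
import Literature.AlgebraicGeometry.Frobenioids.FrobeniusTypePerfect
import HarnessLib

/-!
# [FrdI] Theorem 4.9, proof step T49-L03 (functoriality clause): `Ψ^Φ : Φ₁(A₁) ≅ Φ₂(A₂)` is
# functorial in `A₁ ∈ Ob(C₁^bs-iso)` — proofs

Mochizuki, *The geometry of Frobenioids I: the general theory*, Kyushu J. Math. **62** (2008)
293–400, §4, proof of Theorem 4.9, kurims text p. 89 ll. 25–33
[cite: MochizukiFrdI2008, Thm. 4.9 p.89] (render `paper:url-bbf705efa10f`):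

> "Moreover, by applying, say, the first equivalence of categories of Definition 1.3, (iii), (d),
> to obtain pre-steps `φ : A → B` of `C_i` with arbitrary prescribed zero divisor … one concludes
> immediately that this [isomorphism] maps the subset `Φ₁(A₁) ⊆ Φ₁(A₁)^pf_factor` onto the subset
> `Φ₂(A₂) ⊆ Φ₂(A₂)^pf_factor`, hence determines an isomorphism of monoids `Φ₁(A₁) ≅ Φ₂(A₂)`
> which is functorial in `A₁` [regarded as an object of `C₁^bs-iso`]."

PROOF-ONLY companion of `Thm49Sub.lean` (row `FrdI:Thm4.9/T49-L03`, the clause "functorial in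
`A₁` regarded as an object of `C₁^bs-iso`"; the clause "maps `Φ₁(A₁)` onto `Φ₂(A₂)`" is the
objectwise bijectivity of the transport `Div φ ↦ Div(Ψ φ)`, cf. `PerfFactorialOrderIso.lean`).
Nothing is defined or asserted.

THE POINT. On `Φ₁(A)` the isomorphism `Ψ^Φ_A` is characterised by "pre-steps with prescribed zero
divisor": `Ψ^Φ_A(Div φ) = Div(Ψ φ)` for pre-steps `φ` out of `A` (Def. 1.3 (iii)(d); this is the
first clause of the conclusion of `FrdI.T49.SufficesRightEqLeft`). We prove that ANY family of monoid
homomorphisms `m_A : Φ₁(A) → Φ₂(Ψ A)` with this property is automatically functorial in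
`A ∈ Ob(C₁^bs-iso)`, by the divisor calculus of Rem. 1.1.1
(`Div(χ ∘ ψ) = Base(ψ)^* Div χ + deg_Fr(χ)·Div ψ`):

* along a PRE-STEP `ψ : A → X` (`pull_natural_of_isPreStep`): for `z = Div χ ∈ Φ₁(X)` the composite
  `χ ∘ ψ` is a pre-step out of `A` with `Div(χ ∘ ψ) = ψ^* z + Div ψ`, so the clause at `A` and at `X`
  and the cancellation law of the divisorial monoid `Φ₂(Ψ A)` give `m_A(ψ^* z) = (Ψψ)^* m_X(z)`;
* along a morphism of FROBENIUS TYPE `γ : A → X` of degree `d` (`pull_natural_of_isFrobeniusType`,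
  `C₁` of perfect type): write `γ^* z = d·w` in the perfect monoid `Φ₁(A)` (Prop. 1.10 (iii)), take
  a pre-step `χ' : A → X'` with `Div χ' = w` and a Frobenius-type `γ₁ : X' → Z₁` of degree `d`
  (Def. 1.3 (ii)); re-factoring the base-isomorphism `γ₁ ∘ χ'` as (pre-step) ∘ (Frobenius type)
  (Prop. 1.7 (ii)) and using the essential uniqueness of Frobenius-type morphisms of degree `d` out of
  `A` (Def. 1.3 (ii)) yields a square `χ₂ ∘ γ = γ₁ ∘ χ'` with `χ₂` a pre-step out of `X`,
  `Div χ₂ = z` — the square "of Prop. 1.10 (i)" used on p. 80 for the functoriality of `Ψ^Prime`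
  along morphisms of Frobenius type; reading divisors of its `Ψ`-image gives
  `(Ψγ)^* m_X(z) = d·m_A(w) = m_A(γ^* z)`;
* along every BASE-ISOMORPHISM (`pull_natural_of_isBaseIso_of_div_clause`): base-isomorphism =
  (pre-step) ∘ (Frobenius type), Prop. 1.7 (ii);
* hence, with row T49-L04 (`Thm49FunctorialPullbacks.lean`: pull-back morphisms, Prop. 1.11 (v);
  and Def. 1.3 (iv)(a)), along EVERY morphism of `C₁`.

Consequence for row T49-L02 (`FrdI.T49.sufficesRightEqLeft_conclusion_of_div_clause`): to
establish the conclusion of `FrdI.T49.SufficesRightEqLeft` it suffices to produce, for every object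
`A`, ONE isomorphism of monoids `m_A : Φ₁(A) ≃* Φ₂(Ψ A)` with `m_A(Div φ) = Div(Ψ φ)` for pre-steps
`φ` out of `A`; both functoriality clauses then hold automatically. The hypotheses used are fields
of `FrdI.T42.Setting` (Frobenioids; `C₁` of perfect type; `Ψ` preserves morphisms of Frobenius
type, Frobenius degrees and pull-back morphisms — Thm. 3.4 (iii)). No statement of the paper is
strengthened.
-/

namespace Literature.AlgebraicGeometry.Frobenioids

open CategoryTheory Opposite

universe w v v' u u'

namespace PreFrobenioid

section TwoFrobenioids

variable {D₁ : Type u} [Category.{v} D₁] {Φ₁ : D₁ᵒᵖ ⥤ CommMonCat.{w}} {C₁ : Type u'}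
  [Category.{v'} C₁] {D₂ : Type u} [Category.{v} D₂] {Φ₂ : D₂ᵒᵖ ⥤ CommMonCat.{w}} {C₂ : Type u'}
  [Category.{v'} C₂] {F₁ : C₁ ⥤ ElemFrobenioid Φ₁} {F₂ : C₂ ⥤ ElemFrobenioid Φ₂}

/-- Pulling back divisors along a base-isomorphism is injective (`(Base φ)^*` is bijective,
Rem. 1.1.1). [cite: MochizukiFrdI2008, Rem. 1.1.1] -/
private theorem pull_base_injective {A B : C₁} {φ : A ⟶ B} (h : IsBaseIso F₁ φ) :
    Function.Injective (pull Φ₁ (Base F₁ φ)) := by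
  haveI : IsIso (Base F₁ φ) := h
  intro x y hxy
  have h' := congrArg (pull Φ₁ (inv (Base F₁ φ))) hxy
  rwa [← pull_comp, ← pull_comp, IsIso.inv_hom_id, pull_id, pull_id] at h'

/-- **Functoriality along pre-steps.** Let `G : C₁ → C₂` be a functor between Frobenioids mapping
pre-steps to linear morphisms [e.g. preserving pre-steps, Thm. 3.4 (ii)], and `m_A : Φ₁(A) → Φ₂(G A)`
monoid homomorphisms with `m_A(Div φ) = Div(G φ)` for every pre-step `φ` out of `A`. Then
`m_A(ψ^* z) = (Gψ)^* m_X(z)` for every pre-step `ψ : A → X` and `z ∈ Φ₁(X)`: with `z = Div χ`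
(Def. 1.3 (iii)(d)), `Div(χ ∘ ψ) = ψ^* z + Div ψ` and `Div(Gχ ∘ Gψ) = (Gψ)^* Div(Gχ) + Div(Gψ)`
(Rem. 1.1.1), and `Φ₂(G A)` is cancellative (divisorial). [cite: MochizukiFrdI2008, Thm. 4.9 p.89] -/
theorem pull_natural_of_isPreStep (hF₁ : IsFrobenioid F₁) (hF₂ : IsFrobenioid F₂) (G : C₁ ⥤ C₂)
    (hlin : ∀ ⦃X Y : C₁⦄ (φ : X ⟶ Y), IsPreStep F₁ φ → IsLinear F₂ (G.map φ))
    (m : ∀ A : C₁, Φ₁.obj (op (baseObj F₁ A)) →* Φ₂.obj (op (baseObj F₂ (G.obj A))))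
    (hm : ∀ ⦃A B : C₁⦄ (φ : A ⟶ B), IsPreStep F₁ φ → m A (Div F₁ φ) = Div F₂ (G.map φ))
    ⦃A X : C₁⦄ (ψ : A ⟶ X) (hψ : IsPreStep F₁ ψ) (z : Φ₁.obj (op (baseObj F₁ X))) :
    m A (pull Φ₁ (Base F₁ ψ) z) = pull Φ₂ (Base F₂ (G.map ψ)) (m X z) := by
  have hP₂ := hF₂.isPreFrobenioid
  haveI : IsCancelMul (Φ₂.obj (op (baseObj F₂ (G.obj A)))) :=
    isIntegral_iff_isCancelMul.mp (hP₂.isDivisorial _).isPreDivisorial.isIntegral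
  -- `z = Div χ` for a (co-angular) pre-step `χ` out of `X`
  obtain ⟨Z, χ, hχ, hχz⟩ := hF₁.iii_d_under_surj X z
  have hψχ : IsPreStep F₁ (ψ ≫ χ) := IsPreStep.comp F₁ hψ hχ.2
  -- divisors of `χ ∘ ψ` and of its image
  have h1 : Div F₁ (ψ ≫ χ) = pull Φ₁ (Base F₁ ψ) z * Div F₁ ψ := by
    rw [div_comp, hχz, show degFr F₁ χ = 1 from hχ.2.1, PNat.one_coe, pow_one]
  have h2 : Div F₂ (G.map (ψ ≫ χ)) =
      pull Φ₂ (Base F₂ (G.map ψ)) (Div F₂ (G.map χ)) * Div F₂ (G.map ψ) := by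
    rw [G.map_comp, div_comp, show degFr F₂ (G.map χ) = 1 from hlin χ hχ.2, PNat.one_coe, pow_one]
  have key := hm (ψ ≫ χ) hψχ
  rw [h1, h2, map_mul, ← hm χ hχ.2, ← hm ψ hψ, hχz] at key
  exact mul_right_cancel key

/-- **The square of p. 80 ("cf. Proposition 1.10, (i)") with prescribed divisor.** In a Frobenioid
of perfect type, for a morphism of Frobenius type `γ : A → X` and `z ∈ Φ₁(X)` there are a pre-step
`χ' : A → X'` with `deg_Fr(γ)·Div χ' = γ^* z`, a morphism of Frobenius type `γ₁ : X' → Z₁` with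
`deg_Fr(γ₁) = deg_Fr(γ)`, and a pre-step `χ₂ : X → Z₁` with `Div χ₂ = z`, such that
`χ₂ ∘ γ = γ₁ ∘ χ'` (Prop. 1.10 (iii): `Φ₁(A)` is perfect; Def. 1.3 (ii), (iii)(d); Prop. 1.7 (ii)).
[cite: MochizukiFrdI2008, Thm. 4.2 p.80] -/
theorem exists_frobenius_square_of_div (hF₁ : IsFrobenioid F₁) (hperf : IsOfPerfectType F₁)
    ⦃A X : C₁⦄ (γ : A ⟶ X) (hγ : IsFrobeniusType F₁ γ) (z : Φ₁.obj (op (baseObj F₁ X))) :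
    ∃ (X' Z₁ : C₁) (χ' : A ⟶ X') (γ₁ : X' ⟶ Z₁) (χ₂ : X ⟶ Z₁),
      IsPreStep F₁ χ' ∧ Div F₁ χ' ^ (degFr F₁ γ : ℕ) = pull Φ₁ (Base F₁ γ) z ∧
      IsFrobeniusType F₁ γ₁ ∧ degFr F₁ γ₁ = degFr F₁ γ ∧
      IsPreStep F₁ χ₂ ∧ Div F₁ χ₂ = z ∧ γ ≫ χ₂ = χ' ≫ γ₁ := by
  -- `γ^* z = d · w` in the perfect monoid `Φ₁(A)`
  obtain ⟨w, hw⟩ := ((isPerfect_divisorMonoid hF₁ hperf A).bijective_pow (degFr F₁ γ : ℕ)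
    (degFr F₁ γ).pos).2 (pull Φ₁ (Base F₁ γ) z)
  replace hw : w ^ (degFr F₁ γ : ℕ) = pull Φ₁ (Base F₁ γ) z := hw
  -- a pre-step `χ'` out of `A` with `Div χ' = w`, a Frobenius-type `γ₁` of degree `d` out of `X'`
  obtain ⟨X', χ', hχ', hχ'w⟩ := hF₁.iii_d_under_surj A w
  obtain ⟨Z₁, γ₁, hγ₁, hdeg₁⟩ := hF₁.ii_exists X' (degFr F₁ γ)
  -- re-factor the base-isomorphism `γ₁ ∘ χ'` as (pre-step) ∘ (Frobenius type)
  have hbi : IsBaseIso F₁ (χ' ≫ γ₁) := IsBaseIso.comp F₁ hχ'.2.2 hγ₁.2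
  obtain ⟨X₂, γ₂, χ₂, hfac, hγ₂, hχ₂⟩ :=
    (isBaseIso_iff_exists_frobeniusType_preStep F₁ hF₁ (χ' ≫ γ₁)).mp hbi
  have hdeg₂ : degFr F₁ γ = degFr F₁ γ₂ := by
    have h := congrArg (degFr F₁) hfac
    rw [degFr_comp, degFr_comp, show degFr F₁ χ₂ = 1 from hχ₂.1, show degFr F₁ χ' = 1 from hχ'.2.1,
      mul_one, one_mul, hdeg₁] at h
    exact h.symm
  -- `γ₂ ≅ γ` under `A` (Def. 1.3 (ii), essential uniqueness)
  obtain ⟨b, hb⟩ := hF₁.ii_unique γ γ₂ hγ hγ₂ hdeg₂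
  have hsq : γ ≫ (b.hom ≫ χ₂) = χ' ≫ γ₁ := by rw [← Category.assoc, hb, hfac]
  have hpre : IsPreStep F₁ (b.hom ≫ χ₂) := IsPreStep.comp F₁ (isPreStep_of_isIso F₁ b.hom) hχ₂
  -- divisors: `γ^* Div(χ₂ ∘ b) = Div((χ₂ ∘ b) ∘ γ) = Div(γ₁ ∘ χ') = d · w = γ^* z`
  have hdivsq : pull Φ₁ (Base F₁ γ) (Div F₁ (b.hom ≫ χ₂)) = pull Φ₁ (Base F₁ γ) z := by
    have h1 : Div F₁ (γ ≫ (b.hom ≫ χ₂)) = pull Φ₁ (Base F₁ γ) (Div F₁ (b.hom ≫ χ₂)) := by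
      rw [div_comp, show Div F₁ γ = 1 from hγ.1.2, one_pow, mul_one]
    have h2 : Div F₁ (χ' ≫ γ₁) = w ^ (degFr F₁ γ : ℕ) := by
      rw [div_comp, show Div F₁ γ₁ = 1 from hγ₁.1.2, map_one, one_mul, hχ'w, hdeg₁]
    rw [← h1, hsq, h2, hw]
  refine ⟨X', Z₁, χ', γ₁, b.hom ≫ χ₂, hχ'.2, ?_, hγ₁, hdeg₁, hpre,
    pull_base_injective hγ.2 hdivsq, hsq⟩
  rw [hχ'w, hw]

/-- **Functoriality along morphisms of Frobenius type.** Let `G : C₁ → C₂` be a functor between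
Frobenioids, `C₁` of perfect type, with `G` preserving morphisms of Frobenius type and Frobenius
degrees [Thm. 3.4 (iii)], and `m_A : Φ₁(A) → Φ₂(G A)` monoid homomorphisms with
`m_A(Div φ) = Div(G φ)` for pre-steps `φ` out of `A`. Then `m_A(γ^* z) = (Gγ)^* m_X(z)` for every
morphism of Frobenius type `γ : A → X`: read the divisors of the `G`-image of the square of
`exists_frobenius_square_of_div` (p. 80: "the desired functoriality follows by considering
commutative diagrams … where the vertical morphisms are morphisms of Frobenius type").
[cite: MochizukiFrdI2008, Thm. 4.9 p.89] -/
theorem pull_natural_of_isFrobeniusType (hF₁ : IsFrobenioid F₁) (hperf : IsOfPerfectType F₁)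
    (G : C₁ ⥤ C₂)
    (hfrob : ∀ ⦃X Y : C₁⦄ (φ : X ⟶ Y), IsFrobeniusType F₁ φ → IsFrobeniusType F₂ (G.map φ))
    (hdeg : ∀ ⦃X Y : C₁⦄ (φ : X ⟶ Y), degFr F₂ (G.map φ) = degFr F₁ φ)
    (m : ∀ A : C₁, Φ₁.obj (op (baseObj F₁ A)) →* Φ₂.obj (op (baseObj F₂ (G.obj A))))
    (hm : ∀ ⦃A B : C₁⦄ (φ : A ⟶ B), IsPreStep F₁ φ → m A (Div F₁ φ) = Div F₂ (G.map φ))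
    ⦃A X : C₁⦄ (γ : A ⟶ X) (hγ : IsFrobeniusType F₁ γ) (z : Φ₁.obj (op (baseObj F₁ X))) :
    m A (pull Φ₁ (Base F₁ γ) z) = pull Φ₂ (Base F₂ (G.map γ)) (m X z) := by
  obtain ⟨X', Z₁, χ', γ₁, χ₂, hχ', hχ'w, hγ₁, hdeg₁, hχ₂, hχ₂z, hsq⟩ :=
    exists_frobenius_square_of_div hF₁ hperf γ hγ z
  -- divisors of the image square `Gχ₂ ∘ Gγ = Gγ₁ ∘ Gχ'`
  have h1 : Div F₂ (G.map (γ ≫ χ₂)) = pull Φ₂ (Base F₂ (G.map γ)) (m X z) := by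
    rw [G.map_comp, div_comp, show Div F₂ (G.map γ) = 1 from (hfrob γ hγ).1.2, one_pow, mul_one,
      ← hm χ₂ hχ₂, hχ₂z]
  have h2 : Div F₂ (G.map (χ' ≫ γ₁)) = m A (pull Φ₁ (Base F₁ γ) z) := by
    rw [G.map_comp, div_comp, show Div F₂ (G.map γ₁) = 1 from (hfrob γ₁ hγ₁).1.2, map_one, one_mul,
      hdeg γ₁, hdeg₁, ← hm χ' hχ', ← map_pow, hχ'w]
  rw [← h2, ← hsq, h1]

/-- **T49-L03, functoriality clause: `Ψ^Φ` is functorial in `A₁ ∈ Ob(C₁^bs-iso)`.** Let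
`G : C₁ → C₂` be a functor between Frobenioids, `C₁` of perfect type, `G` mapping pre-steps to
linear morphisms and preserving morphisms of Frobenius type and Frobenius degrees [Thm. 3.4
(ii)(iii)]; let `m_A : Φ₁(A) → Φ₂(G A)` be monoid homomorphisms with `m_A(Div φ) = Div(G φ)` for
pre-steps `φ` out of `A`. Then `m_A(φ^* z) = (Gφ)^* m_B(z)` for every base-isomorphism `φ : A → B`
(base-isomorphism = (pre-step) ∘ (Frobenius type), Prop. 1.7 (ii)).
[cite: MochizukiFrdI2008, Thm. 4.9 p.89] -/
theorem pull_natural_of_isBaseIso_of_div_clause (hF₁ : IsFrobenioid F₁) (hF₂ : IsFrobenioid F₂)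
    (hperf : IsOfPerfectType F₁) (G : C₁ ⥤ C₂)
    (hlin : ∀ ⦃X Y : C₁⦄ (φ : X ⟶ Y), IsPreStep F₁ φ → IsLinear F₂ (G.map φ))
    (hfrob : ∀ ⦃X Y : C₁⦄ (φ : X ⟶ Y), IsFrobeniusType F₁ φ → IsFrobeniusType F₂ (G.map φ))
    (hdeg : ∀ ⦃X Y : C₁⦄ (φ : X ⟶ Y), degFr F₂ (G.map φ) = degFr F₁ φ)
    (m : ∀ A : C₁, Φ₁.obj (op (baseObj F₁ A)) →* Φ₂.obj (op (baseObj F₂ (G.obj A))))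
    (hm : ∀ ⦃A B : C₁⦄ (φ : A ⟶ B), IsPreStep F₁ φ → m A (Div F₁ φ) = Div F₂ (G.map φ))
    ⦃A B : C₁⦄ (φ : A ⟶ B) (hφ : IsBaseIso F₁ φ) (z : Φ₁.obj (op (baseObj F₁ B))) :
    m A (pull Φ₁ (Base F₁ φ) z) = pull Φ₂ (Base F₂ (G.map φ)) (m B z) := by
  obtain ⟨X, γ, ψ, hfac, hγ, hψ⟩ := (isBaseIso_iff_exists_frobeniusType_preStep F₁ hF₁ φ).mp hφ
  subst hfac
  simp only [base_comp, pull_comp, Functor.map_comp]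
  rw [pull_natural_of_isFrobeniusType hF₁ hperf G hfrob hdeg m hm γ hγ,
    pull_natural_of_isPreStep hF₁ hF₂ G hlin m hm ψ hψ]

/-- **Functorial on `C₁`.** Under the hypotheses of `pull_natural_of_isBaseIso_of_div_clause` and
with `G` preserving pull-back morphisms [Thm. 3.4 (iii)], the family `m` is natural along EVERY
morphism of `C₁` (base-isomorphisms above; pull-back morphisms by row T49-L04,
`pull_natural_of_isPullbackMorphism`; assembly by Def. 1.3 (iv)(a),
`pull_natural_of_baseIso_of_pullback`). [cite: MochizukiFrdI2008, Thm. 4.9 p.89] -/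
theorem pull_natural_of_div_clause (hF₁ : IsFrobenioid F₁) (hF₂ : IsFrobenioid F₂)
    (hperf : IsOfPerfectType F₁) (G : C₁ ⥤ C₂)
    (hlin : ∀ ⦃X Y : C₁⦄ (φ : X ⟶ Y), IsPreStep F₁ φ → IsLinear F₂ (G.map φ))
    (hfrob : ∀ ⦃X Y : C₁⦄ (φ : X ⟶ Y), IsFrobeniusType F₁ φ → IsFrobeniusType F₂ (G.map φ))
    (hdeg : ∀ ⦃X Y : C₁⦄ (φ : X ⟶ Y), degFr F₂ (G.map φ) = degFr F₁ φ)
    (hpb : ∀ ⦃X Y : C₁⦄ (φ : X ⟶ Y), IsPullbackMorphism F₁ φ → IsPullbackMorphism F₂ (G.map φ))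
    (m : ∀ A : C₁, Φ₁.obj (op (baseObj F₁ A)) →* Φ₂.obj (op (baseObj F₂ (G.obj A))))
    (hm : ∀ ⦃A B : C₁⦄ (φ : A ⟶ B), IsPreStep F₁ φ → m A (Div F₁ φ) = Div F₂ (G.map φ))
    ⦃A B : C₁⦄ (φ : A ⟶ B) (z : Φ₁.obj (op (baseObj F₁ B))) :
    m A (pull Φ₁ (Base F₁ φ) z) = pull Φ₂ (Base F₂ (G.map φ)) (m B z) :=
  pull_natural_of_baseIso_of_pullback hF₁ G (fun A => m A)
    (pull_natural_of_isBaseIso_of_div_clause hF₁ hF₂ hperf G hlin hfrob hdeg m hm)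
    (pull_natural_of_isPullbackMorphism hF₁ hF₂ G hpb (fun A => m A) (fun _ _ φ h => hm φ h.2)) φ z

end TwoFrobenioids

end PreFrobenioid

/-! ### In the binders of `FrdI.T49.SufficesRightEqLeft` -/

namespace FrdI.T49

variable {D₁ : Type u} [Category.{v} D₁] {Φ₁ : D₁ᵒᵖ ⥤ CommMonCat.{w}} {C₁ : Type u'}
  [Category.{v'} C₁] {D₂ : Type u} [Category.{v} D₂] {Φ₂ : D₂ᵒᵖ ⥤ CommMonCat.{w}} {C₂ : Type u'}
  [Category.{v'} C₂] {F₁ : C₁ ⥤ ElemFrobenioid Φ₁} {F₂ : C₂ ⥤ ElemFrobenioid Φ₂} {Ψ : C₁ ≌ C₂}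

/-- **T49-L03, functoriality clause, as consumed by `SufficesRightEqLeft`.** In a
`T42.Setting F₁ F₂ Ψ`, every family of monoid isomorphisms `m_A : Φ₁(A) ≃* Φ₂(Ψ A)` with the
pre-step clause `m_A(Div φ) = Div(Ψ φ)` is functorial in `A ∈ Ob(C₁^bs-iso)`.
[cite: MochizukiFrdI2008, Thm. 4.9 p.89] -/
theorem functorialBaseIsos (S : T42.Setting F₁ F₂ Ψ)
    (m : ∀ A : C₁, Φ₁.obj (op (PreFrobenioid.baseObj F₁ A)) ≃*
      Φ₂.obj (op (PreFrobenioid.baseObj F₂ (Ψ.functor.obj A))))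
    (hm : ∀ ⦃A B : C₁⦄ (φ : A ⟶ B), PreFrobenioid.IsPreStep F₁ φ →
      m A (PreFrobenioid.Div F₁ φ) = PreFrobenioid.Div F₂ (Ψ.functor.map φ))
    ⦃A B : C₁⦄ (φ : A ⟶ B) (hφ : PreFrobenioid.IsBaseIso F₁ φ)
    (z : Φ₁.obj (op (PreFrobenioid.baseObj F₁ B))) :
    m A (pull Φ₁ (PreFrobenioid.Base F₁ φ) z) =
      pull Φ₂ (PreFrobenioid.Base F₂ (Ψ.functor.map φ)) (m B z) :=
  PreFrobenioid.pull_natural_of_isBaseIso_of_div_clause S.isFrobenioid₁ S.isFrobenioid₂ S.perfect₁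
    Ψ.functor (fun _ _ φ h => (S.preStep_map φ h).1) S.frobeniusType_map S.degFr_map
    (fun A => (m A).toMonoidHom) hm φ hφ z

/-- **Functorial on `C₁`** (rows T49-L03 + T49-L04): in a `T42.Setting F₁ F₂ Ψ`, every family of
monoid isomorphisms `m_A : Φ₁(A) ≃* Φ₂(Ψ A)` with the pre-step clause is natural along every
morphism of `C₁` — the second clause of the conclusion of `SufficesRightEqLeft`.
[cite: MochizukiFrdI2008, Thm. 4.9 p.89] -/
theorem natural_of_div_clause (S : T42.Setting F₁ F₂ Ψ)
    (m : ∀ A : C₁, Φ₁.obj (op (PreFrobenioid.baseObj F₁ A)) ≃*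
      Φ₂.obj (op (PreFrobenioid.baseObj F₂ (Ψ.functor.obj A))))
    (hm : ∀ ⦃A B : C₁⦄ (φ : A ⟶ B), PreFrobenioid.IsPreStep F₁ φ →
      m A (PreFrobenioid.Div F₁ φ) = PreFrobenioid.Div F₂ (Ψ.functor.map φ))
    ⦃A B : C₁⦄ (φ : A ⟶ B) (z : Φ₁.obj (op (PreFrobenioid.baseObj F₁ B))) :
    m A (pull Φ₁ (PreFrobenioid.Base F₁ φ) z) =
      pull Φ₂ (PreFrobenioid.Base F₂ (Ψ.functor.map φ)) (m B z) :=
  natural_of_baseIso_natural S m hm (functorialBaseIsos S m hm) φ z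

/-- **Reduction of `SufficesRightEqLeft`'s conclusion to an objectwise statement.** In a
`T42.Setting F₁ F₂ Ψ`, a family of monoid isomorphisms `m_A : Φ₁(A) ≃* Φ₂(Ψ A)` (one for each
object, no compatibility between different objects assumed) satisfying the pre-step clause
ALREADY witnesses the full conclusion `∃ m, (pre-step clause) ∧ (functorial on C₁)` of
`FrdI.T49.SufficesRightEqLeft`. [cite: MochizukiFrdI2008, Thm. 4.9 p.89] -/
theorem sufficesRightEqLeft_conclusion_of_div_clause (S : T42.Setting F₁ F₂ Ψ)
    (m : ∀ A : C₁, Φ₁.obj (op (PreFrobenioid.baseObj F₁ A)) ≃*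
      Φ₂.obj (op (PreFrobenioid.baseObj F₂ (Ψ.functor.obj A))))
    (hm : ∀ ⦃A B : C₁⦄ (φ : A ⟶ B), PreFrobenioid.IsPreStep F₁ φ →
      m A (PreFrobenioid.Div F₁ φ) = PreFrobenioid.Div F₂ (Ψ.functor.map φ)) :
    ∃ m : ∀ A : C₁, Φ₁.obj (op (PreFrobenioid.baseObj F₁ A)) ≃*
        Φ₂.obj (op (PreFrobenioid.baseObj F₂ (Ψ.functor.obj A))),
      (∀ ⦃A B : C₁⦄ (φ : A ⟶ B), PreFrobenioid.IsPreStep F₁ φ →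
          m A (PreFrobenioid.Div F₁ φ) = PreFrobenioid.Div F₂ (Ψ.functor.map φ)) ∧
      ∀ ⦃A B : C₁⦄ (φ : A ⟶ B) (x : Φ₁.obj (op (PreFrobenioid.baseObj F₁ B))),
        m A (pull Φ₁ (PreFrobenioid.Base F₁ φ) x) =
          pull Φ₂ (PreFrobenioid.Base F₂ (Ψ.functor.map φ)) (m B x) :=
  ⟨m, hm, natural_of_div_clause S m hm⟩

/-- **Objectwise existence with the pre-step clause suffices** (pointwise-`∃` form: the family may be
chosen by the axiom of choice, since no compatibility between objects is required).
[cite: MochizukiFrdI2008, Thm. 4.9 p.89] -/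
theorem sufficesRightEqLeft_conclusion_of_forall_exists (S : T42.Setting F₁ F₂ Ψ)
    (h : ∀ A : C₁, ∃ mA : Φ₁.obj (op (PreFrobenioid.baseObj F₁ A)) ≃*
        Φ₂.obj (op (PreFrobenioid.baseObj F₂ (Ψ.functor.obj A))),
      ∀ ⦃B : C₁⦄ (φ : A ⟶ B), PreFrobenioid.IsPreStep F₁ φ →
        mA (PreFrobenioid.Div F₁ φ) = PreFrobenioid.Div F₂ (Ψ.functor.map φ)) :
    ∃ m : ∀ A : C₁, Φ₁.obj (op (PreFrobenioid.baseObj F₁ A)) ≃*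
        Φ₂.obj (op (PreFrobenioid.baseObj F₂ (Ψ.functor.obj A))),
      (∀ ⦃A B : C₁⦄ (φ : A ⟶ B), PreFrobenioid.IsPreStep F₁ φ →
          m A (PreFrobenioid.Div F₁ φ) = PreFrobenioid.Div F₂ (Ψ.functor.map φ)) ∧
      ∀ ⦃A B : C₁⦄ (φ : A ⟶ B) (x : Φ₁.obj (op (PreFrobenioid.baseObj F₁ B))),
        m A (pull Φ₁ (PreFrobenioid.Base F₁ φ) x) =
          pull Φ₂ (PreFrobenioid.Base F₂ (Ψ.functor.map φ)) (m B x) := by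
  choose m hm using h
  exact sufficesRightEqLeft_conclusion_of_div_clause S m (fun A _ φ hφ => hm A φ hφ)

end FrdI.T49

end Literature.AlgebraicGeometry.Frobenioids
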